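import Summits.AnomalousDissipation.AnomalousDissipation.Theorems.SawtoothPulseCascadeK3LocalisedClosureApproxBookkeeping
import Summits.AnomalousDissipation.AnomalousDissipation.Theorems.SawtoothPulseCascadeK3LocalisedClosureApproxResponse
import Summits.AnomalousDissipation.AnomalousDissipation.Theorems.SawtoothPulseCascadeLipAgmonEnvelopeOfL2P
import Summits.AnomalousDissipation.AnomalousDissipation.Theorems.SawtoothPulseCascadeLipAgmonCaps
import Summits.AnomalousDissipation.AnomalousDissipation.Theorems.SawtoothPulseCascadeApproxEnvelopePH

/-!
# `ApproximateSolution ⟨γ, δ₀, 2, 1, 2⟩ (γ²−3)` from a K2-cap WITHIN THE HORIZON (the weakest K2 the closure consumes)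
(route `AnomalousDissipation/SawtoothPulseCascade`; helper for the crux K1loc = stmt-AnomalousDissipation-19491 —
sequel of `…LipAgmonApproxSolPC` (p666807); no route-file import)

`LipAgmon.approximateSolution_PH`: as `approximateSolution_PC`, but the per-phase cap `(C e^{σ⋆γ})^{J+1−j₀}` of the
linearised cascade is only assumed for the phases `j₀ ≤ J < J_{γ²−3}(ν) + A` below the horizon, for each lag `A` with
its own threshold `ν₀(A)` — the hypothesis shape of `ApproxResponse.responseL2EnvelopePH`.  In every phase it mentions
the analyticity budget `16π²νN_J²tHalf_J ≤ δ_J²` holds for `ν ≤ ν_b(A, δ₀)` (`pbudget_threshold`): viscosity is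
perturbative at the corner scale, so the K2 crux restricted this way is a statement about the (almost) inviscid
linearised cascade only.
-/

set_option linter.dupNamespace false

noncomputable section

open Set MeasureTheory
open Literature.Analysis Literature.Analysis.FunctionSpaces Literature.Analysis.FluidPDE
open Literature.Analysis.FluidPDE.SawtoothCascade
open Literature.Analysis.FluidPDE.SawtoothCascade.DriftFree

namespace Summit.AnomalousDissipation.AnomalousDissipation.Theorems.SawtoothPulseCascade

namespace LipAgmon

/-- **`ApproximateSolution ⟨γ, δ₀, 2, 1, 2⟩ (γ²−3)` from a K2-cap within the horizon** (`γ ∈ [5,8]`, `0 < δ₀`,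
`0 ≤ C`, `C·e^{σ⋆γ} < γ² − 3`; the cap only for phases `J < J_{γ²−3}(ν) + A`, threshold `ν₀(A)` per lag):
S1 = `ApproxResponse.responseL2EnvelopePH`, S2 = `lipEnvelope_of_caps_of_L2_P` + `caps_H`/`caps_V`,
S3 = `DriftFreeApprox.envelopeBookkeeping`, assembled by `approximateSolution_of_envelopes`. [folklore] -/
theorem approximateSolution_PH {γ : ℝ} (hγ : γ ∈ Icc (5 : ℝ) 8) {δ₀ : ℝ} (hδ₀ : 0 < δ₀) {C : ℝ} (hC0 : 0 ≤ C)
    (hCr : C * Real.exp (sawSigmaStar * γ) < γ ^ 2 - 3)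
    (hK2 : ∀ A : ℕ, ∃ ν₀ : ℝ, 0 < ν₀ ∧ ∀ ν ∈ Ioc 0 ν₀, ∀ (j₀ J : ℕ), j₀ ≤ J → J < Jrate (γ ^ 2 - 3) ν + A →
      ∀ (hz : Bool) (w₀ : UnitAddTorus (Fin 2) → EuclideanSpace ℝ (Fin 2))
        (w : ℝ → UnitAddTorus (Fin 2) → EuclideanSpace ℝ (Fin 2)) (q : ℝ → UnitAddTorus (Fin 2) → ℝ),
        ShearCombDatum (((⟨γ, δ₀, 2, 1, 2⟩ : CascadeParams)).N j₀) hz w₀ →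
        Torus.IsSmoothSpaceTimeOn (Icc (CascadeParams.tInject j₀ hz) (CascadeParams.tStart (J + 1))) w →
        Torus.IsSmoothSpaceTimeOn (Icc (CascadeParams.tInject j₀ hz) (CascadeParams.tStart (J + 1))) q →
        (∀ t ∈ Icc (CascadeParams.tInject j₀ hz) (CascadeParams.tStart (J + 1)), Torus.IsDivFree (w t)) →
        (∀ t ∈ Icc (CascadeParams.tInject j₀ hz) (CascadeParams.tStart (J + 1)), ∀ x,
          Torus.timeDerivWithin (Icc (CascadeParams.tInject j₀ hz) (CascadeParams.tStart (J + 1))) w t x +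
            Torus.convect ((⟨γ, δ₀, 2, 1, 2⟩ : CascadeParams).field t) (w t) x +
            Torus.convect (w t) ((⟨γ, δ₀, 2, 1, 2⟩ : CascadeParams).field t) x =
            ν • Torus.laplacian (w t) x - Torus.gradient (q t) x) →
        w (CascadeParams.tInject j₀ hz) = w₀ →
        ∀ t ∈ Icc (max (CascadeParams.tInject j₀ hz) (CascadeParams.tStart J)) (CascadeParams.tStart (J + 1)),
          Torus.vectorL2Sq (w t) ≤ (C * Real.exp (sawSigmaStar * γ)) ^ (2 * (J + 1 - j₀)) * Torus.vectorL2Sq w₀) :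
    ApproximateSolution ⟨γ, δ₀, 2, 1, 2⟩ (γ ^ 2 - 3) := by
  have hγ0 : (0 : ℝ) ≤ γ := le_trans (by norm_num) hγ.1
  have hρN : (2 : ℕ) ∈ Finset.Icc 2 7 := Finset.mem_Icc.2 ⟨le_rfl, by norm_num⟩
  have hL2 := ApproxResponse.responseL2EnvelopePH hγ hδ₀ hρN hC0 hCr hK2
  obtain ⟨M₁, K₁, hM₁0, hM₁, hK₁0, H2⟩ := lipEnvelope_of_caps_of_L2_P hγ hδ₀ (c₃ := 8 * Real.pi ^ 2)
    (c₄ := 80 * Real.pi ^ 3 / Real.sqrt (2 * Real.pi)) (c₅ := 192 * Real.pi ^ 4) (by positivity) (by positivity)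
    (by positivity) (fun ν j => caps_H ⟨γ, δ₀, 2, 1, 2⟩ hγ0 hδ₀ (by norm_num) ν j)
    (fun ν j => caps_V ⟨γ, δ₀, 2, 1, 2⟩ hγ0 hδ₀ (by norm_num) ν j) hL2
  obtain ⟨M₂, K₂, hM₂0, hM₂, hK₂0, H1⟩ := hL2
  refine DriftFreeApprox.approximateSolution_of_envelopes ⟨γ, δ₀, 2, 1, 2⟩ hγ0 hδ₀ (by norm_num) ?_
  intro A ε hε
  obtain ⟨ν₁, hν₁, H1A⟩ := H1 A
  obtain ⟨ν₂, hν₂, H2A⟩ := H2 A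
  obtain ⟨ν₃, hν₃, H3A⟩ :=
    DriftFreeApprox.envelopeBookkeeping γ hγ 2 hρN M₁ M₂ K₁ K₂ hM₁0 hM₁ hM₂0 hM₂ hK₁0 hK₂0 A ε hε
  refine ⟨min ν₁ (min ν₂ ν₃), lt_min hν₁ (lt_min hν₂ hν₃), fun ν hν => ?_⟩
  have hn1 : ν ∈ Set.Ioc 0 ν₁ := ⟨hν.1, hν.2.trans (min_le_left _ _)⟩
  have hn2 : ν ∈ Set.Ioc 0 ν₂ := ⟨hν.1, (hν.2.trans (min_le_right _ _)).trans (min_le_left _ _)⟩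
  have hn3 : ν ∈ Set.Ioc 0 ν₃ := ⟨hν.1, (hν.2.trans (min_le_right _ _)).trans (min_le_right _ _)⟩
  set T := horizon (γ ^ 2 - 3) ν A with hT
  have hT0 : 0 ≤ T := CascadeParams.tStart_nonneg _
  have hT1 : T < 1 := CascadeParams.tStart_lt_one _
  set T' : ℝ := (T + 1) / 2 with hT'
  have hTT' : T < T' := by rw [hT']; linarith
  have hT'1 : T' < 1 := by rw [hT']; linarith
  have hT'0 : 0 < T' := hT0.trans_lt hTT'
  obtain ⟨L, q, hL, hq, hdiv, hL0, hlin⟩ :=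
    DriftFreeApprox.exists_linearisedResponse ⟨γ, δ₀, 2, 1, 2⟩ hδ₀ (by norm_num) hν.1 hT'0 hT'1
  obtain ⟨Λ, hΛc, hΛ, hΛle⟩ := H2A ν hn2 T' hTT' hT'1 L q hL hq hdiv hL0 hlin
  have hEle := H1A ν hn1 T' hTT' hT'1 L q hL hq hdiv hL0 hlin
  set E : ℝ → ℝ := fun t => Real.sqrt (FluidPDE.Torus.vectorL2Sq (L t)) with hE
  have hEc : ContinuousOn E (Set.Icc 0 T) := by
    have h := (hL.continuousOn_integral_norm_sq (convex_Icc 0 T')).mono (Set.Icc_subset_Icc le_rfl hTT'.le)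
    exact (Real.continuous_sqrt.comp_continuousOn h).congr fun s _ => rfl
  have henv : ∀ j : ℕ, ∀ t ∈ Set.Icc 0 T, t ∈ Set.Icc (CascadeParams.tStart j) (CascadeParams.tStart (j + 1)) →
      0 ≤ E t ∧ E t ≤ K₂ * ν * ((j : ℝ) + 1) * M₂ ^ (j + 1) ∧
      0 ≤ Λ t ∧ Λ t ≤ K₁ * ν * ((j : ℝ) + 1) * M₁ ^ (j + 1) :=
    fun j t ht hj => ⟨Real.sqrt_nonneg _, hEle j t ht hj, (norm_nonneg _).trans (hΛ t ht 0), hΛle j t ht hj⟩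
  obtain ⟨hint, hdef⟩ := H3A ν hn3 E Λ hEc hΛc henv
  exact ⟨T', hTT', hT'1, L, q, E, Λ, hL, hq, hdiv, hL0, hlin, fun t _ => le_rfl, hΛ, hEc, hΛc, hint, hdef⟩

end LipAgmon

end Summit.AnomalousDissipation.AnomalousDissipation.Theorems.SawtoothPulseCascade

end
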